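import Summits.QuantumFields.BalabanUV.T4Continuum.Support.NE3CombGauge
import HarnessLib

/-!
# T⁴ programme, node NE3 — row E-MLw-(w4)P, sub-row C0, file 2: THE COMB-TRANSPORTED CORNER CHARGE AND THE DEFECT FUNCTIONAL

NE3 (node U1b) formalisation swarm `b2b-balaban-t4-ne3-formalise-*`, leaf seat `b2b-balaban-t4-ne3-formalise-leaf-01`
(gen 5), row **C0** of the owner's design `HOME/t4/b2b-balaban-t4-ne3-p1/g21/D-ne3p1-g21-1.md` §3–§4 (RULING ρ-g21-2,
`HOME/CLAIMS.log` l.15420; my CLAIM l.15469; SHAPE `HOME/t4/formal/NE3/Statements/C0-COMB-GAUGE-SHAPE-v1.md`).  File 1 =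
`NE3CombGauge` (geometry, the comb gauge `W₀ = W^{btree}`, the bond bound, log form, comb loops).

WHY.  In the design's step (C4a) the frame potential `μ(z)` of a block is transported from the corner `M•z` along the comb,
`Φ_W(x) = Ad_{W(Γ_{M•z,x})⁻¹} μ(z)`, and paired with a tangent direction through its covariant derivative; the interior part of
that derivative is the COMB-LOOP DEFECT, and the located inequality (μK) is about the functional
`K_B(Y) = Σ_{b∈B°}(Ad_{W(loop_b)⁻¹} − 1)(Y b)`.  THIS FILE (0 `def`, 0 `sorry`, all [folklore]) supplies the exact algebra and the
crude bounds:

§6 for ANY site gauge `u` and charge `m`: `gaugeDir W (Ad_{u(·)⁻¹} m) (x,μ) = Ad_{u(x+e_μ)⁻¹}(Ad_{(W^{u})(x,μ)⁻¹} m − m)` EXACTLY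
   (`gaugeDir_Ad_inv_eq`); with `u = btree M W z`: `‖gaugeDir W Φ (x,μ)‖ ≤ 2·|lowPart μ (x − M•z)|₁·a·‖m‖ ≤ 2dMa‖m‖` on the double
   block, and `= 0` on comb bonds;
§7 `‖Σ_{b∈F}(Ad_{W₀(b)^{±1}}(Y b) − Y b)‖ ≤ 2·d·M·a·Σ_{b∈F}‖Y b‖ ≤ 2dMa·√(#F)·√(Σ‖Y b‖²)` for bonds `F` of the double block
   (generic unitary version `norm_sum_Ad_inv_sub_le` included).

HONEST FRAMING.  Kinematics/algebra on our lattice objects ([folklore]; context [Balaban1985Averaging] (8) p. 18, p. 24–25);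
no estimate of NE3's; nothing about Bałaban's minimisers; (P_W), (ML_w), T-E_w, (μK) and **NE3 are NOT proved**; spine PROVED
0∕9; finite T⁴ rung (B)+1 — NOT infinite volume, NOT mass gap, NOT `BetaPertH`, NOT Clay.  PLACEMENT:
`Summits/QuantumFields/BalabanUV/`; imports file 1 BY NAME.  HONEST DEPENDENCY (cell page 1): continuum YM on T⁴ ⇐ BetaPertH ∧
nine spine estimates (0/9 proved); BetaPertH ⇐ (D1) ∧ (D4) ∧ CAP+tail; G-an2-4 gates asym, D1 and NE2/3/4.
-/

set_option autoImplicit false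

open scoped BigOperators Matrix Matrix.Norms.L2Operator
open NormedSpace Finset

namespace Summit.QuantumFields.BalabanUV.T4Continuum.NE3CombGaugeCharge

open Literature.MathematicalPhysics.QuantumFieldTheory.Balaban1983to89
open B7Prop1Explicit B7Prop2Explicit
open B8Lemma1NonAbelian (lowPart pairTop)
open T4AveragingDeficitWall (IsUnitaryCfg SmallField Ad)
open T4AveragingDeficitNonAbelian (Ad_mul Ad_sub)
open AveragingDeficitNearIdentity (Ad_one norm_Ad_sub_le)
open AveragingDeficitTransport (norm_Ad_of_unitary mem_U1_of_unitary)
open AveragingDeficitBlockDensity (btree btree_mem)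
open SpreadLiftDirection (isUnitaryCfg_gaugeAct')
open BlockAveragePushDirGauge (gaugeDir)
open NE3CombGauge (isUnitaryCfg_comb norm_comb_sub_one_le norm_comb_sub_one_le_pair comb_eq_one_of_lowPart)

noncomputable section

variable {d : ℕ} {n : Type*} [Fintype n] [DecidableEq n]

/-! ## §6 The transported corner charge and its covariant derivative (the algebra behind (C4a)) -/

/-- **COVARIANT DERIVATIVE OF A COMB-TRANSPORTED CONSTANT**: for ANY site gauge `u` and any `m`, the site field
`Φ(y) = Ad_{u(y)⁻¹} m` has gauge direction `gaugeDir W Φ (x, μ) = Ad_{u(x+e_μ)⁻¹}(Ad_{(W^{u})(x,μ)⁻¹} m − m)` EXACTLY — the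
failure of `Φ` to be covariantly constant along `b` is the defect of the gauge-fixed bond variable. [folklore] -/
theorem gaugeDir_Ad_inv_eq (W : Site d → Fin d → (Matrix n n ℂ)ˣ) (u : Site d → (Matrix n n ℂ)ˣ) (m : Matrix n n ℂ)
    (x : Site d) (μ : Fin d) :
    gaugeDir W (fun y => Ad (u y)⁻¹ m) x μ = Ad (u (x + e μ))⁻¹ (Ad (gaugeAct u W x μ)⁻¹ m - m) := by
  unfold gaugeDir
  rw [Ad_sub, ← Ad_mul, ← Ad_mul]
  congr 2
  simp only [gaugeAct, mul_inv_rev, inv_inv, inv_mul_cancel_left]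

/-- **GAUGE COVARIANCE OF THE ORBIT TANGENT** (varying charge): for ANY site gauge `u` and site field `m`,
`gaugeDir (W^{u}) m (x, μ) = Ad_{u(x+e_μ)} (gaugeDir W (Ad_{u(·)⁻¹} m(·)) (x, μ))` — the gauge direction generated by `m` at the
gauge-fixed background is the transported gauge direction generated by the back-transported charge; with `u = btree` and
`m = μ(z(·))` block-constant this is the interior/face bookkeeping of the design's `Φ_W`. [cite: Balaban1985Averaging, (8) p.18, (45) p.24] -/
theorem gaugeDir_gaugeAct_eq (W : Site d → Fin d → (Matrix n n ℂ)ˣ) (u : Site d → (Matrix n n ℂ)ˣ) (m : Site d → Matrix n n ℂ)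
    (x : Site d) (μ : Fin d) :
    gaugeDir (gaugeAct u W) m x μ = Ad (u (x + e μ)) (gaugeDir W (fun y => Ad (u y)⁻¹ (m y)) x μ) := by
  unfold gaugeDir
  rw [Ad_sub, ← Ad_mul, ← Ad_mul, ← Ad_mul, mul_inv_cancel, Ad_one]
  congr 2
  simp only [gaugeAct, mul_inv_rev, inv_inv, mul_assoc]

/-- The same read backwards: `gaugeDir W (Ad_{u(·)⁻¹} m(·)) (x, μ) = Ad_{u(x+e_μ)⁻¹} (gaugeDir (W^{u}) m (x, μ))`. [folklore] -/
theorem gaugeDir_Ad_inv_eq' (W : Site d → Fin d → (Matrix n n ℂ)ˣ) (u : Site d → (Matrix n n ℂ)ˣ) (m : Site d → Matrix n n ℂ)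
    (x : Site d) (μ : Fin d) :
    gaugeDir W (fun y => Ad (u y)⁻¹ (m y)) x μ = Ad (u (x + e μ))⁻¹ (gaugeDir (gaugeAct u W) m x μ) := by
  rw [gaugeDir_gaugeAct_eq, ← Ad_mul, inv_mul_cancel, Ad_one]

/-- Its norm: `‖gaugeDir W Φ (x, μ)‖ ≤ 2·‖(W^{u})(x,μ) − 1‖·‖m‖` for unitary `u`, `W`. [folklore] -/
theorem norm_gaugeDir_Ad_inv_le [Nonempty n] {W : Site d → Fin d → (Matrix n n ℂ)ˣ} (hW : IsUnitaryCfg W)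
    {u : Site d → (Matrix n n ℂ)ˣ} (hu : ∀ y, u y ∈ unitaryUnits (Matrix n n ℂ)) (m : Matrix n n ℂ) (x : Site d) (μ : Fin d) :
    ‖gaugeDir W (fun y => Ad (u y)⁻¹ m) x μ‖ ≤ 2 * ‖((gaugeAct u W x μ : (Matrix n n ℂ)ˣ) : Matrix n n ℂ) - 1‖ * ‖m‖ := by
  have hg : gaugeAct u W x μ ∈ unitaryUnits (Matrix n n ℂ) := isUnitaryCfg_gaugeAct' hu hW x μ
  rw [gaugeDir_Ad_inv_eq, norm_Ad_of_unitary ((unitaryUnits (Matrix n n ℂ)).inv_mem (hu _))]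
  refine (norm_Ad_sub_le ((unitaryUnits (Matrix n n ℂ)).inv_mem hg) m).trans ?_
  gcongr
  exact norm_inv_sub_one_le (mem_U1_of_unitary hg)

section Charge

variable [Nonempty n] {M : ℕ} {W : Site d → Fin d → (Matrix n n ℂ)ˣ} (hW : IsUnitaryCfg W) {a : ℝ} (hWa : SmallField W a)
include hW hWa

/-- **THE COMB-TRANSPORTED CORNER CHARGE**: `Φ(y) = Ad_{btree(y)⁻¹} m` (the charge `m` sitting at the corner `M•z`, transported
along the comb) has `‖gaugeDir W Φ (x, μ)‖ ≤ 2·|lowPart μ (x − M•z)|₁·a·‖m‖` for `M•z ≤ x` — the comb-loop defect of the design with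
the frame `Ad_{btree(x+e_μ)⁻¹}` made explicit by `gaugeDir_Ad_inv_eq`. [folklore] -/
theorem norm_gaugeDir_combCharge_le (z : Site d) (m : Matrix n n ℂ) {x : Site d} (hx : (M : ℤ) • z ≤ x) (μ : Fin d) :
    ‖gaugeDir W (fun y => Ad (btree M W z y)⁻¹ m) x μ‖ ≤ 2 * (l1 (lowPart μ (x - (M : ℤ) • z)) * a) * ‖m‖ := by
  refine (norm_gaugeDir_Ad_inv_le hW (fun y => btree_mem hW M z y) m x μ).trans ?_
  gcongr
  exact norm_comb_sub_one_le hW hWa z hx μ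

/-- … uniform on the double block: `≤ 2·d·M·a·‖m‖`. [folklore] -/
theorem norm_gaugeDir_combCharge_le_pair (ha : 0 ≤ a) (z : Site d) (κ : Fin d) (m : Matrix n n ℂ) {x : Site d}
    (hx : (M : ℤ) • z ≤ x) (hx' : x ≤ (M : ℤ) • z + pairTop M κ) (μ : Fin d) :
    ‖gaugeDir W (fun y => Ad (btree M W z y)⁻¹ m) x μ‖ ≤ 2 * ((d : ℝ) * M * a) * ‖m‖ := by
  refine (norm_gaugeDir_Ad_inv_le hW (fun y => btree_mem hW M z y) m x μ).trans ?_
  gcongr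
  exact norm_comb_sub_one_le_pair hW hWa ha z κ hx hx' μ

end Charge

/-- On comb bonds the transported charge IS covariantly constant: `gaugeDir W Φ (x, μ) = 0`. [folklore] -/
theorem gaugeDir_combCharge_eq_zero (M : ℕ) (W : Site d → Fin d → (Matrix n n ℂ)ˣ) (z : Site d) (m : Matrix n n ℂ)
    (x : Site d) (μ : Fin d) (h : lowPart μ (x - (M : ℤ) • z) = 0) :
    gaugeDir W (fun y => Ad (btree M W z y)⁻¹ m) x μ = 0 := by
  rw [gaugeDir_Ad_inv_eq, comb_eq_one_of_lowPart M W z x μ h, inv_one, Ad_one, sub_self, AveragingDeficitNearIdentity.Ad_zero]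

/-! ## §7 The defect functional (the shape of `K_B`) -/

/-- **GENERIC DEFECT SUM**: unitary `g_b` with `‖g_b − 1‖ ≤ t` on `F` ⇒ `‖Σ_{b∈F}(Ad_{g_b⁻¹}(Y b) − Y b)‖ ≤ 2t·Σ_{b∈F}‖Y b‖`. [folklore] -/
theorem norm_sum_Ad_inv_sub_le [Nonempty n] {ι : Type*} (F : Finset ι) {g : ι → (Matrix n n ℂ)ˣ}
    (hg : ∀ b ∈ F, g b ∈ unitaryUnits (Matrix n n ℂ)) {t : ℝ} (ht : ∀ b ∈ F, ‖((g b : (Matrix n n ℂ)ˣ) : Matrix n n ℂ) - 1‖ ≤ t)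
    (Y : ι → Matrix n n ℂ) :
    ‖∑ b ∈ F, (Ad (g b)⁻¹ (Y b) - Y b)‖ ≤ 2 * t * ∑ b ∈ F, ‖Y b‖ := by
  rw [mul_sum]
  refine (norm_sum_le _ _).trans (sum_le_sum fun b hb => ?_)
  refine (norm_Ad_sub_le ((unitaryUnits (Matrix n n ℂ)).inv_mem (hg b hb)) _).trans ?_
  have h1 := (norm_inv_sub_one_le (mem_U1_of_unitary (hg b hb))).trans (ht b hb)
  have h0 : 0 ≤ t := (norm_nonneg _).trans h1
  gcongr

/-- The same with `Ad_{g_b}`. [folklore] -/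
theorem norm_sum_Ad_sub_le [Nonempty n] {ι : Type*} (F : Finset ι) {g : ι → (Matrix n n ℂ)ˣ}
    (hg : ∀ b ∈ F, g b ∈ unitaryUnits (Matrix n n ℂ)) {t : ℝ} (ht : ∀ b ∈ F, ‖((g b : (Matrix n n ℂ)ˣ) : Matrix n n ℂ) - 1‖ ≤ t)
    (Y : ι → Matrix n n ℂ) :
    ‖∑ b ∈ F, (Ad (g b) (Y b) - Y b)‖ ≤ 2 * t * ∑ b ∈ F, ‖Y b‖ := by
  rw [mul_sum]
  refine (norm_sum_le _ _).trans (sum_le_sum fun b hb => ?_)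
  refine (norm_Ad_sub_le (hg b hb) _).trans ?_
  have h0 : 0 ≤ t := (norm_nonneg _).trans (ht b hb)
  gcongr
  exact ht b hb

/-- `ℓ¹ ≤ √# · ℓ²` on a finite index set (Cauchy–Schwarz). [folklore] -/
theorem sum_norm_le_sqrt_card_mul_sqrt {ι : Type*} (F : Finset ι) (Y : ι → Matrix n n ℂ) :
    ∑ b ∈ F, ‖Y b‖ ≤ Real.sqrt F.card * Real.sqrt (∑ b ∈ F, ‖Y b‖ ^ 2) := by
  have h := Real.sum_mul_le_sqrt_mul_sqrt F (fun _ => (1 : ℝ)) (fun b => ‖Y b‖)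
  simp only [one_mul, one_pow, sum_const, nsmul_eq_mul, mul_one] at h
  exact h

section Functional

variable [Nonempty n] {M : ℕ} {W : Site d → Fin d → (Matrix n n ℂ)ˣ} (hW : IsUnitaryCfg W) {a : ℝ} (ha : 0 ≤ a)
  (hWa : SmallField W a)
include hW ha hWa

/-- **THE COMB-DEFECT FUNCTIONAL ON THE DOUBLE BLOCK, `ℓ¹` FORM**: for a finite set `F` of bonds with initial points in
`[M•z, M•z + pairTop M κ]` and any bond data `Y`,
`‖Σ_{b∈F} (Ad_{W₀(b)⁻¹}(Y b) − Y b)‖ ≤ 2·d·M·a · Σ_{b∈F} ‖Y b‖` (`W₀ = W^{btree}`; the frame in which `Y b` is read is the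
caller's). [folklore] -/
theorem norm_sum_combDefect_le (z : Site d) (κ : Fin d) (F : Finset (Site d × Fin d))
    (hF : ∀ b ∈ F, (M : ℤ) • z ≤ b.1 ∧ b.1 ≤ (M : ℤ) • z + pairTop M κ) (Y : Site d × Fin d → Matrix n n ℂ) :
    ‖∑ b ∈ F, (Ad (gaugeAct (btree M W z) W b.1 b.2)⁻¹ (Y b) - Y b)‖ ≤ 2 * ((d : ℝ) * M * a) * ∑ b ∈ F, ‖Y b‖ :=
  norm_sum_Ad_inv_sub_le F (fun b _ => isUnitaryCfg_comb hW M z b.1 b.2)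
    (fun b hb => norm_comb_sub_one_le_pair hW hWa ha z κ (hF b hb).1 (hF b hb).2 b.2) Y

/-- The same with `Ad_{W₀(b)}`. [folklore] -/
theorem norm_sum_combDefect_le' (z : Site d) (κ : Fin d) (F : Finset (Site d × Fin d))
    (hF : ∀ b ∈ F, (M : ℤ) • z ≤ b.1 ∧ b.1 ≤ (M : ℤ) • z + pairTop M κ) (Y : Site d × Fin d → Matrix n n ℂ) :
    ‖∑ b ∈ F, (Ad (gaugeAct (btree M W z) W b.1 b.2) (Y b) - Y b)‖ ≤ 2 * ((d : ℝ) * M * a) * ∑ b ∈ F, ‖Y b‖ :=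
  norm_sum_Ad_sub_le F (fun b _ => isUnitaryCfg_comb hW M z b.1 b.2)
    (fun b hb => norm_comb_sub_one_le_pair hW hWa ha z κ (hF b hb).1 (hF b hb).2 b.2) Y

/-- **… `ℓ²` FORM**: `‖Σ_{b∈F} (Ad_{W₀(b)⁻¹}(Y b) − Y b)‖ ≤ 2·d·M·a·√(#F)·√(Σ_{b∈F}‖Y b‖²)` (the design's
`‖K_B(Y)‖ ≤ C·a·M^{1+d/2}·‖Y‖_{ℓ²(B)}` reading when `#F ≤ d·(2M)^d`). [folklore] -/
theorem norm_sum_combDefect_le_sqrt (z : Site d) (κ : Fin d) (F : Finset (Site d × Fin d))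
    (hF : ∀ b ∈ F, (M : ℤ) • z ≤ b.1 ∧ b.1 ≤ (M : ℤ) • z + pairTop M κ) (Y : Site d × Fin d → Matrix n n ℂ) :
    ‖∑ b ∈ F, (Ad (gaugeAct (btree M W z) W b.1 b.2)⁻¹ (Y b) - Y b)‖
      ≤ 2 * ((d : ℝ) * M * a) * (Real.sqrt F.card * Real.sqrt (∑ b ∈ F, ‖Y b‖ ^ 2)) := by
  refine (norm_sum_combDefect_le hW ha hWa z κ F hF Y).trans ?_
  have : 0 ≤ 2 * ((d : ℝ) * M * a) := by positivity
  exact mul_le_mul_of_nonneg_left (sum_norm_le_sqrt_card_mul_sqrt F Y) this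

end Functional

end

end Summit.QuantumFields.BalabanUV.T4Continuum.NE3CombGaugeCharge
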